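import Summits.ResolutionOfSingularities.ResolutionOfSingularities.Theorems.FrobeniusClosingCampaignW41Core4HahnDefs
import Mathlib.Algebra.CharP.Lemmas
import Literature.AlgebraicGeometry.Resolution.SubfieldTransport
import HarnessLib

/-!
# Crux `Steer` (stmt-16345), chain W4.1 / kill test K4.1b: the `x`-adic valuation ring of a Hahn-series field

OURS (campaign `res-hironaka`, rung L, slot W4.1; replaces the role of no printed item; NOT a statement of
the manuscript under review). First brick of the KERNEL inhabitant of the registered dim-`≥ 4` Steer core
`Sig.stub_steerDefectCore4` (line `switching_dichotomy`; K4.1b «ALIVE-BY-KERNEL», seat res-L0-k41): the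
ambient valued field is a Hahn-series field `Ω = k⟦x^Γ⟧` (`HahnSeries Γ k`, `Γ` a linearly ordered abelian
group, `k` a field) with its `x`-adic (order) valuation.

* the dictionary `valuation … < / ≤ / =` ↔ `orderTop … > / ≥ / =` for the order valuation `hahnVal Γ k`
  of `HahnSeries Γ k` and its valuation ring `𝒪 Γ k` (definitions in `…Core4HahnDefs.lean`).
* transport to any field `K` mapped into `Ω` by a ring hom `ι` (`O := (𝒪 Γ k).comap ι`): the same dictionary
  for `O.valuation`.
* `pow_char_sub_self_mem_nonunits`: over `k = 𝔽_p` every `h ∈ 𝒪` satisfies `h ^ p - h ∈ 𝔪_𝒪` (its residue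
  lies in `𝔽_p`) — the input for the skeleton's `ZeroDim` with the single polynomial `X ^ p - X`.
* elementary membership facts for `PInv p = ℤ[1/p] ⊂ ℚ` (the value group of the datum).

No `Theses.*` / `Cruxes.*` import (chain build rule, CHAIN W4.1 §imports). All statements are folklore.
-/

-- layout-mandated namespace `Summit.<Summit>.<Problem>.…` with Summit = Problem (single-conjunct summit)
set_option linter.dupNamespace false

namespace Summit.ResolutionOfSingularities.ResolutionOfSingularities.Theorems.SwitchingDichotomy.Core4Hahn


/-! ## `ℤ[1/p]`: elementary membership facts -/

/-- `m / p ^ n ∈ ℤ[1/p]` (`p ≠ 0`). [folklore] -/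
theorem div_pow_mem_PInv {p : ℕ} (hp : p ≠ 0) (m : ℤ) (n : ℕ) : (m : ℚ) / (p : ℚ) ^ n ∈ PInv p := by
  refine ⟨n, m, ?_⟩
  have : (p : ℚ) ^ n ≠ 0 := pow_ne_zero _ (Nat.cast_ne_zero.mpr hp)
  rw [div_mul_cancel₀ _ this]

/-- `1 / p ^ n ∈ ℤ[1/p]` (`p ≠ 0`). [folklore] -/
theorem inv_pow_mem_PInv {p : ℕ} (hp : p ≠ 0) (n : ℕ) : ((p : ℚ) ^ n)⁻¹ ∈ PInv p := by
  have h := div_pow_mem_PInv hp 1 n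
  rwa [Int.cast_one, one_div] at h

/-- `ℤ[1/p]` is `p`-divisible: `q / p ∈ ℤ[1/p]` for `q ∈ ℤ[1/p]`. [folklore] -/
theorem div_mem_PInv {p : ℕ} {q : ℚ} (hq : q ∈ PInv p) : q / p ∈ PInv p := by
  obtain ⟨n, m, h⟩ := hq
  by_cases hp : (p : ℚ) = 0
  · exact ⟨0, 0, by simp [hp]⟩
  refine ⟨n + 1, m, ?_⟩
  rw [pow_succ', ← mul_assoc, div_mul_cancel₀ _ hp, h]

/-- Elements of `ℤ[1/p]` have the form `m / p ^ n` (`p ≠ 0`). [folklore] -/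
theorem exists_eq_div_of_mem_PInv {p : ℕ} (hp : p ≠ 0) {q : ℚ} (hq : q ∈ PInv p) :
    ∃ n : ℕ, ∃ m : ℤ, q = m / (p : ℚ) ^ n := by
  obtain ⟨n, m, h⟩ := hq
  refine ⟨n, m, ?_⟩
  have : (p : ℚ) ^ n ≠ 0 := pow_ne_zero _ (Nat.cast_ne_zero.mpr hp)
  rw [eq_div_iff this, h]

/-! ## The order valuation of a Hahn-series field and its valuation ring -/

section General

variable (Γ : Type*) [AddCommGroup Γ] [LinearOrder Γ] [IsOrderedAddMonoid Γ] (k : Type*) [Field k]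

variable {Γ k}

/-- Formula for the order valuation. [folklore] -/
theorem hahnVal_apply (h : HahnSeries Γ k) :
    hahnVal Γ k h = Multiplicative.ofAdd (OrderDual.toDual h.orderTop) := by
  rw [hahnVal, AddValuation.toValuation_apply, HahnSeries.addVal_apply]

/-- `v h ≤ v h' ↔ orderTop h' ≤ orderTop h`. [folklore] -/
theorem hahnVal_le_iff {h h' : HahnSeries Γ k} :
    hahnVal Γ k h ≤ hahnVal Γ k h' ↔ h'.orderTop ≤ h.orderTop := by
  rw [hahnVal_apply, hahnVal_apply, Multiplicative.ofAdd_le, OrderDual.toDual_le_toDual]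

/-- `v h < v h' ↔ orderTop h' < orderTop h`. [folklore] -/
theorem hahnVal_lt_iff {h h' : HahnSeries Γ k} :
    hahnVal Γ k h < hahnVal Γ k h' ↔ h'.orderTop < h.orderTop := by
  rw [hahnVal_apply, hahnVal_apply, Multiplicative.ofAdd_lt, OrderDual.toDual_lt_toDual]

/-- `v h = v h' ↔ orderTop h = orderTop h'`. [folklore] -/
theorem hahnVal_eq_iff {h h' : HahnSeries Γ k} :
    hahnVal Γ k h = hahnVal Γ k h' ↔ h.orderTop = h'.orderTop := by
  rw [hahnVal_apply, hahnVal_apply]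
  constructor
  · intro e
    exact OrderDual.toDual.injective (Multiplicative.ofAdd.injective e)
  · intro e
    rw [e]

/-- `v h ≤ 1 ↔ 0 ≤ orderTop h`. [folklore] -/
theorem hahnVal_le_one_iff {h : HahnSeries Γ k} : hahnVal Γ k h ≤ 1 ↔ 0 ≤ h.orderTop := by
  rw [← (hahnVal Γ k).map_one, hahnVal_le_iff, HahnSeries.orderTop_one]

/-- `v h < 1 ↔ 0 < orderTop h`. [folklore] -/
theorem hahnVal_lt_one_iff {h : HahnSeries Γ k} : hahnVal Γ k h < 1 ↔ 0 < h.orderTop := by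
  rw [← (hahnVal Γ k).map_one, hahnVal_lt_iff, HahnSeries.orderTop_one]

/-- Membership in `𝒪`: non-negative order. [folklore] -/
theorem mem_𝒪_iff {h : HahnSeries Γ k} : h ∈ 𝒪 Γ k ↔ 0 ≤ h.orderTop := by
  rw [𝒪, Valuation.mem_valuationSubring_iff, hahnVal_le_one_iff]

/-- The canonical valuation of `𝒪` is equivalent to the order valuation. [folklore] -/
theorem isEquiv_hahnVal : (hahnVal Γ k).IsEquiv (𝒪 Γ k).valuation :=
  Valuation.isEquiv_valuation_valuationSubring _

/-- Dictionary: `𝒪.valuation h < 𝒪.valuation h' ↔ orderTop h' < orderTop h`. [folklore] -/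
theorem valuation_𝒪_lt_iff {h h' : HahnSeries Γ k} :
    (𝒪 Γ k).valuation h < (𝒪 Γ k).valuation h' ↔ h'.orderTop < h.orderTop := by
  rw [← isEquiv_hahnVal.lt_iff_lt, hahnVal_lt_iff]

/-- Dictionary: `𝒪.valuation h ≤ 𝒪.valuation h' ↔ orderTop h' ≤ orderTop h`. [folklore] -/
theorem valuation_𝒪_le_iff {h h' : HahnSeries Γ k} :
    (𝒪 Γ k).valuation h ≤ (𝒪 Γ k).valuation h' ↔ h'.orderTop ≤ h.orderTop := by
  rw [← isEquiv_hahnVal.le_iff_le, hahnVal_le_iff]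

/-- Dictionary: `𝒪.valuation h = 𝒪.valuation h' ↔ orderTop h = orderTop h'`. [folklore] -/
theorem valuation_𝒪_eq_iff {h h' : HahnSeries Γ k} :
    (𝒪 Γ k).valuation h = (𝒪 Γ k).valuation h' ↔ h.orderTop = h'.orderTop := by
  rw [← isEquiv_hahnVal.eq_iff, hahnVal_eq_iff]

/-- Dictionary: `𝒪.valuation h < 1 ↔ 0 < orderTop h`. [folklore] -/
theorem valuation_𝒪_lt_one_iff {h : HahnSeries Γ k} : (𝒪 Γ k).valuation h < 1 ↔ 0 < h.orderTop := by
  rw [← isEquiv_hahnVal.lt_one_iff_lt_one, hahnVal_lt_one_iff]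

/-- Dictionary: `h ∈ 𝒪.nonunits ↔ 0 < orderTop h`. [folklore] -/
theorem mem_nonunits_𝒪_iff {h : HahnSeries Γ k} : h ∈ (𝒪 Γ k).nonunits ↔ 0 < h.orderTop := by
  rw [ValuationSubring.mem_nonunits_iff, valuation_𝒪_lt_one_iff]

omit [IsOrderedAddMonoid Γ] in
/-- A monomial of positive exponent has positive order. [folklore] -/
theorem orderTop_single_pos {g : Γ} (hg : 0 < g) (c : k) : 0 < (HahnSeries.single g c).orderTop :=
  lt_of_lt_of_le (WithTop.coe_pos.mpr hg) HahnSeries.orderTop_single_le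

/-- In `WithTop Γ`, a positive multiple of a positive element is positive. [folklore] -/
theorem nsmul_pos_withTop {t : WithTop Γ} (ht : 0 < t) {n : ℕ} (hn : n ≠ 0) : 0 < n • t := by
  obtain ⟨m, rfl⟩ := Nat.exists_eq_succ_of_ne_zero hn
  rw [succ_nsmul]
  exact lt_of_lt_of_le ht (le_add_of_nonneg_left (nsmul_nonneg ht.le m))

/-- Positive order is stable under powers with positive exponent. [folklore] -/
theorem orderTop_pow_pos {h : HahnSeries Γ k} (hh : 0 < h.orderTop) {n : ℕ} (hn : n ≠ 0) :
    0 < (h ^ n).orderTop :=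
  lt_of_lt_of_le (nsmul_pos_withTop hh hn) HahnSeries.orderTop_nsmul_le_orderTop_pow

omit [IsOrderedAddMonoid Γ] in
/-- Positive order is stable under differences. [folklore] -/
theorem orderTop_sub_pos {h h' : HahnSeries Γ k} (hh : 0 < h.orderTop) (hh' : 0 < h'.orderTop) :
    0 < (h - h').orderTop :=
  lt_of_lt_of_le (lt_min hh hh') HahnSeries.min_orderTop_le_orderTop_sub

omit [IsOrderedAddMonoid Γ] in
/-- Positive order is stable under sums. [folklore] -/
theorem orderTop_add_pos {h h' : HahnSeries Γ k} (hh : 0 < h.orderTop) (hh' : 0 < h'.orderTop) :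
    0 < (h + h').orderTop :=
  lt_of_lt_of_le (lt_min hh hh') HahnSeries.min_orderTop_le_orderTop_add

/-- Positive order is stable under products with elements of `𝒪`. [folklore] -/
theorem orderTop_mul_pos {h h' : HahnSeries Γ k} (hh : 0 < h.orderTop) (hh' : 0 ≤ h'.orderTop) :
    0 < (h * h').orderTop :=
  lt_of_lt_of_le (lt_of_lt_of_le hh (le_add_of_nonneg_right hh')) HahnSeries.orderTop_add_le_mul

/-- **The residue of an element of `𝒪` is its constant coefficient**: `h - HahnSeries.C (h.coeff 0)` has positive
order for `h ∈ 𝒪`. [folklore] -/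
theorem orderTop_sub_C_coeff_zero_pos {h : HahnSeries Γ k} (hh : 0 ≤ h.orderTop) :
    0 < (h - HahnSeries.C (h.coeff 0)).orderTop := by
  set h' := h - HahnSeries.C (h.coeff 0) with hh'
  by_cases h0 : h' = 0
  · rw [h0, HahnSeries.orderTop_zero]
    exact WithTop.coe_lt_top 0
  have hcoeff : ∀ g : Γ, g ≤ 0 → h'.coeff g = 0 := by
    intro g hg
    rcases lt_or_eq_of_le hg with hlt | rfl
    · have h1 : h.coeff g = 0 := HahnSeries.coeff_eq_zero_of_lt_orderTop (lt_of_lt_of_le (WithTop.coe_lt_coe.mpr hlt) hh)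
      rw [hh', HahnSeries.coeff_sub, HahnSeries.C_apply, HahnSeries.coeff_single_of_ne hlt.ne, h1, sub_zero]
    · rw [hh', HahnSeries.coeff_sub, HahnSeries.C_apply, HahnSeries.coeff_single_same, sub_self]
  rw [HahnSeries.zero_lt_orderTop_iff h0]
  refine lt_of_le_of_ne ((HahnSeries.le_order_iff_forall h0).mpr fun j hj => hcoeff j hj.le) ?_
  intro h00
  exact h0 (HahnSeries.coeff_order_eq_zero.mp (hcoeff _ h00.symm.le))

end General

/-! ## Residues over `𝔽_p`: the polynomial `X ^ p - X` kills every residue -/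

section FiniteField

variable (Γ : Type*) [AddCommGroup Γ] [LinearOrder Γ] [IsOrderedAddMonoid Γ] (p : ℕ) [Fact p.Prime]

/-- `HahnSeries Γ 𝔽_p` has characteristic `p`. [folklore] -/
theorem charP_hahnSeries : CharP (HahnSeries Γ (ZMod p)) p :=
  charP_of_injective_ringHom (HahnSeries.C_injective (Γ := Γ) (R := ZMod p)) p

variable {Γ p}

/-- **Over `𝔽_p` every element of `𝒪` satisfies `h ^ p - h ∈ 𝔪_𝒪`** (its residue `c ∈ 𝔽_p` has
`c ^ p = c`). This gives the skeleton's `ZeroDim` for every valuation ring obtained from `𝒪` by restriction,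
with the single non-zero polynomial `X ^ p - X`. [folklore] -/
theorem orderTop_pow_char_sub_self_pos {h : HahnSeries Γ (ZMod p)} (hh : 0 ≤ h.orderTop) :
    0 < (h ^ p - h).orderTop := by
  haveI := charP_hahnSeries Γ p
  have hp : (p : ℕ) ≠ 0 := (Fact.out : p.Prime).ne_zero
  set c := h.coeff 0
  set h' := h - HahnSeries.C c with hh'
  have hpos : 0 < h'.orderTop := orderTop_sub_C_coeff_zero_pos hh
  have hdecomp : h = HahnSeries.C c + h' := by rw [hh']; abel
  have key : h ^ p - h = h' ^ p - h' := by
    conv_lhs => rw [hdecomp]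
    rw [add_pow_char, ← map_pow, ZMod.pow_card]
    abel
  rw [key]
  exact orderTop_sub_pos (orderTop_pow_pos hpos hp) hpos

/-- The same, as membership in the non-units of `𝒪`. [folklore] -/
theorem pow_char_sub_self_mem_nonunits {h : HahnSeries Γ (ZMod p)} (hh : h ∈ 𝒪 Γ (ZMod p)) :
    h ^ p - h ∈ (𝒪 Γ (ZMod p)).nonunits :=
  mem_nonunits_𝒪_iff.mpr (orderTop_pow_char_sub_self_pos (mem_𝒪_iff.mp hh))

end FiniteField

/-! ## Transport to a field mapped into the Hahn-series field -/

section Transport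

variable {Γ : Type*} [AddCommGroup Γ] [LinearOrder Γ] [IsOrderedAddMonoid Γ] {k : Type*} [Field k]
  {K : Type*} [Field K] (ι : K →+* HahnSeries Γ k)

/-- Dictionary for the restricted valuation ring `O = ι⁻¹ 𝒪`: `<`. [folklore] -/
theorem valuation_comap_lt_iff (a b : K) :
    ((𝒪 Γ k).comap ι).valuation a < ((𝒪 Γ k).comap ι).valuation b ↔ (ι b).orderTop < (ι a).orderTop := by
  rw [← (Literature.AlgebraicGeometry.Resolution.isEquiv_valuation_comap ι
    (V' := 𝒪 Γ k) (V := (𝒪 Γ k).comap ι) rfl).lt_iff_lt, Valuation.comap_apply, Valuation.comap_apply,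
    valuation_𝒪_lt_iff]

/-- Dictionary for `O = ι⁻¹ 𝒪`: `≤`. [folklore] -/
theorem valuation_comap_le_iff (a b : K) :
    ((𝒪 Γ k).comap ι).valuation a ≤ ((𝒪 Γ k).comap ι).valuation b ↔ (ι b).orderTop ≤ (ι a).orderTop := by
  rw [← (Literature.AlgebraicGeometry.Resolution.isEquiv_valuation_comap ι
    (V' := 𝒪 Γ k) (V := (𝒪 Γ k).comap ι) rfl).le_iff_le, Valuation.comap_apply, Valuation.comap_apply,
    valuation_𝒪_le_iff]

/-- Dictionary for `O = ι⁻¹ 𝒪`: `=`. [folklore] -/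
theorem valuation_comap_eq_iff (a b : K) :
    ((𝒪 Γ k).comap ι).valuation a = ((𝒪 Γ k).comap ι).valuation b ↔ (ι a).orderTop = (ι b).orderTop := by
  rw [← (Literature.AlgebraicGeometry.Resolution.isEquiv_valuation_comap ι
    (V' := 𝒪 Γ k) (V := (𝒪 Γ k).comap ι) rfl).eq_iff, Valuation.comap_apply, Valuation.comap_apply,
    valuation_𝒪_eq_iff]

/-- Dictionary for `O = ι⁻¹ 𝒪`: `< 1`. [folklore] -/
theorem valuation_comap_lt_one_iff (a : K) :
    ((𝒪 Γ k).comap ι).valuation a < 1 ↔ 0 < (ι a).orderTop := by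
  have h := valuation_comap_lt_iff ι a 1
  rwa [map_one, map_one, HahnSeries.orderTop_one] at h

/-- Dictionary for `O = ι⁻¹ 𝒪`: non-units. [folklore] -/
theorem mem_nonunits_comap_iff (a : K) :
    a ∈ ((𝒪 Γ k).comap ι).nonunits ↔ 0 < (ι a).orderTop := by
  rw [ValuationSubring.mem_nonunits_iff, valuation_comap_lt_one_iff]

/-- Dictionary for `O = ι⁻¹ 𝒪`: membership. [folklore] -/
theorem mem_comap_𝒪_iff (a : K) : a ∈ (𝒪 Γ k).comap ι ↔ 0 ≤ (ι a).orderTop := by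
  rw [ValuationSubring.mem_comap, mem_𝒪_iff]

end Transport

end Summit.ResolutionOfSingularities.ResolutionOfSingularities.Theorems.SwitchingDichotomy.Core4Hahn
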